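import Literature.MathematicalPhysics.KineticTheory.TaggedSphereLinearBoltzmannInputs
import Literature.MathematicalPhysics.KineticTheory.TaggedSphereDomainInputs
import Literature.MathematicalPhysics.KineticTheory.HierarchyDuhamelSeriesOn
import Literature.MathematicalPhysics.KineticTheory.HardSphereBBGKYRobustness
import HarnessLib

/-!
# The linear Boltzmann limit of the tagged sphere (fact (c)) from the three inputs (S), (R), (Reg)
(Bodineau–Gallagher–Saint-Raymond, Invent. Math. 203 (2016) = arXiv:1305.3397v2, Theorem 2.2 and
its proof, §5.3.4 Prop. 5.8, pp. 7, 21 of the held text `lit read arxiv:1305.3397`; van Beijeren–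
Lanford–Lebowitz–Spohn, J. Stat. Phys. 22 (1980) for `α = 1`; trunk T-KINETIC, topic
MathematicalPhysics/KineticTheory; the (c)-specific top of the bottom-up plan towards the named
fact `bodineau_gallagher_saintRaymond_linear` (`ShortRangePotentials`), recorded in
`TaggedSphereLinearBoltzmann` (N1).)

The tree now holds the whole assembled comparison of BGSR §4–§5 between the tagged-particle
distribution `f_N^{(1)}` and the solution `M_β φ_α` of the linear Boltzmann equation, CONDITIONALLY
on three inputs on the hard-sphere dynamics (`TaggedSphereMainTermComparison`,
`ae_abs_bgsrMarginalFamily_sub_bgsrHierarchyFamily_le(_dom)`: an explicit almost-everywhere bound at time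
`Kh` for every admissible choice of the parameters `A, K, h, γ, E, δ, ε₀, ā`; and
`TaggedSphereLinearBoltzmannInputs`, which tunes it into the printed rate (2.9) for `α > 1`,
`t > 1`). The inputs are: (S) the iterated Duhamel formula up to null sets for the marginals along
the regularised hard-sphere flows, (R') the Duhamel terms of the hard-sphere model respect null
sets ON FAMILIES SUPPORTED IN THE HARD-SPHERE DOMAINS (`HierarchyModel.RespectsAEOn`,
`HierarchyDuhamelSeriesOn`; equivalently `RespectsAE (hsDomMeasure ε)` of `TaggedSphereDomainInputs`,
through which the assembled comparison is consumed — the unrestricted form (R) of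
`HardSphereHierarchyModel` is false for the hard-sphere model, see those files; (R') is proved in
`HardSphereBBGKYRobustness`), (Reg) almost every one-particle configuration is regular to all depths
(`bgsrRegular`, `PseudoTrajectoryCoupling`; proved in `HardSphereBBGKYRegularity`).

Fact (c) is the case `α = 1` (outside the printed range `α > 1` of (2.9)) and needs every
`t ≥ 0` (not only `t > 1`), but only QUALITATIVELY: weak convergence along Boltzmann–Grad
sequences, which N1 reduced to the almost-everywhere convergence `BgsrAeConvergenceAt 1`
(`linearBoltzmannLimitAt_of_ae`, `bodineau_gallagher_saintRaymond_linear_of_limitAt_one`). This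
file PROVES that qualitative statement at EVERY `α > 0` from the same three inputs, by a tuning of
the assembled comparison adapted to an exact Boltzmann–Grad sequence (`(N_k + 1) ε_k^{d-1} = α`,
`ε_k → 0`) at a fixed time `t > 0` and accuracy `η > 0`: since the pruning constants `c_R ∝ α` do
not depend on `k`, the number of blocks `K`, the step `h = t/K`, the pruning parameter `γ`
(`A = 2`) and the energy cut-off `E` are chosen ONCE in terms of `η` (making the pruning and
energy-truncation errors `≤ 3η/8`), after which the separation `δ_k = ε_k^{1/3}`, the bad-set
radii `ε₀ = ε_k^{2/3}`, `ā = (L_K + 1) ε_k` and the bad-set measure (`TaggedSphereComparisonTuning`)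
tend to zero with `ε_k`, and so do the data and prefactor discrepancies `2^d α ε_k`,
`L_K ε_k^{d-1}/α`; hence eventually `|f_{N_k}^{(1)}(t) - M_β φ_α(t)| ≤ η` almost everywhere, which is
a.e. convergence (`ae_tendsto_of_forall_eventually_ae_le`).

* `Kinetic.bgsrAeConvergenceAt_of_inputs` — (S), (R), (Reg) imply `BgsrAeConvergenceAt α` for
  every `α > 0`;
* `Kinetic.linearBoltzmannLimitAt_of_inputs`, `Kinetic.bodineau_gallagher_saintRaymond_linear_of_inputs`
  — hence the weak-convergence statement (c) at every `α > 0`, and the named fact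
  `bodineau_gallagher_saintRaymond_linear` (`α = 1`), from the three inputs.

No new definition and no named fact is introduced; what remains of fact (c) is exactly (S), (R),
(Reg). The regularity input (Reg) is only required for physical diameters `0 < ε < 1/2` (the
range of Alexander's theorem on the unit torus), which is all the comparison consumes.

## References

* T. Bodineau, I. Gallagher, L. Saint-Raymond, *The Brownian motion as the limit of a
  deterministic system of hard-spheres*, Invent. Math. 203 (2016) 493–553 = arXiv:1305.3397v2,
  Thm 2.2 p. 7; §5.3.4 Prop. 5.8 and proof of Thm 2.2, p. 21.
* H. van Beijeren, O. E. Lanford, J. L. Lebowitz, H. Spohn, *Equilibrium time correlation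
  functions in the low-density limit*, J. Stat. Phys. 22 (1980) 237–257.
-/

open MeasureTheory Metric Real Set Filter Function Asymptotics
open scoped InnerProductSpace ENNReal Nat Topology
open Literature.Analysis.FluidPDE (Config configEnergy Geometry GCState hardSphereDomain freeFlight
  bgsrGoodConfigs HardSphereFlow)
open Literature.Analysis.FunctionSpaces (maxwellianBeta)

namespace Literature.MathematicalPhysics.KineticTheory

noncomputable section

open Literature.Analysis.FunctionSpaces.Torus Literature.Analysis.FluidPDE.Torus

section Kinetic

variable {d : Type*} [Fintype d]

/-! ## §1. Elementary lemmas -/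

/-- The pruning constant of the Boltzmann model on `T^d` with rate `α ≥ 0`:
`c_R = (4√2 C_d √2^d / √b^{d+1}) · α`. [folklore] -/
theorem pruneConst_boltzmannModel_torus {α : ℝ} (hα : 0 ≤ α) (b : ℝ) :
    (boltzmannModel (Literature.Analysis.FluidPDE.Torus.geometry d) measurable_translate_torus α).pruneConst b =
      (4 * sqrt 2 * ((∫ u : EuclideanSpace ℝ d, (1 + ‖u‖) * exp (-(1 / 2) * ‖u‖ ^ 2)) *
          (sphereMeasure (E := EuclideanSpace ℝ d)).real univ) * sqrt 2 ^ Fintype.card d /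
          sqrt b ^ (Fintype.card d + 1)) * α := by
  show 4 * sqrt 2 * (|α| * ((∫ u : EuclideanSpace ℝ d, (1 + ‖u‖) * exp (-(1 / 2) * ‖u‖ ^ 2)) *
        (sphereMeasure (E := EuclideanSpace ℝ d)).real univ)) * sqrt 2 ^ Fintype.card d /
      sqrt b ^ (Fintype.card d + 1) = _
  rw [abs_of_nonneg hα]
  ring

omit [Fintype d] in
/-- Along an exact Boltzmann–Grad sequence the diameters' sixth roots tend to `0`. [folklore] -/
theorem tendsto_rpow_sixth_of_tendsto_zero {ε : ℕ → ℝ} (hε : Tendsto ε atTop (𝓝 0)) :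
    Tendsto (fun k => ε k ^ ((1 : ℝ) / 6)) atTop (𝓝 0) := by
  have h := hε.rpow_const (p := (1 : ℝ) / 6) (Or.inr (by norm_num))
  rwa [Real.zero_rpow (by norm_num)] at h

omit [Fintype d] in
/-- `(ε^{1/6})^6 = ε` for `ε ≥ 0`. [folklore] -/
theorem rpow_sixth_pow_six {ε : ℝ} (hε : 0 ≤ ε) : (ε ^ ((1 : ℝ) / 6)) ^ 6 = ε := by
  rw [← Real.rpow_natCast, ← Real.rpow_mul hε]
  norm_num

/-! ## §2. Almost-everywhere convergence at every `α > 0` from the inputs -/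

set_option maxHeartbeats 400000 in
/-- **The a.e. form of BGSR Theorem 2.2 at every inverse mean free path `α > 0`, from the three
inputs (S), (R), (Reg).** For `d ≥ 2`, `β > 0`, an exact Boltzmann–Grad sequence
(`(N_k + 1) ε_k^{d-1} = α`, `ε_k → 0`, `ε_k < 1/2`), a continuous probability density `ρ⁰ ≥ 0` on
`T^d` and hard-sphere flows `Φ_k`, the collision-series solution `φ_α` of the linear Boltzmann
equation (1.3) (`linearBoltzmannSeries`, `IsTaggedLinearBoltzmannSolution`) satisfies, for every
`t > 0`, `f_{N_k}^{(1)}(t, z) → M_β(v) φ_α(t, z)` for a.e. `z = (x, v)`. Proof: for `η > 0`, the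
assembled comparison `ae_abs_bgsrMarginalFamily_sub_bgsrHierarchyFamily_le_dom` at time `t = Kh`
with `A = 2`, `γ = min(1/2, η/(8(4RC' + 2R'C_m + 1)))`, `K = ⌈e² C' c_β α t/γ⌉ + 1`,
`E² = (4/β) max(1, log(4(Q+1)/η))` (all independent of `k`; `R = max ρ⁰`, `C' = max 1 (2(β/2π)^{d/2})`,
`C_m = max 1 (β/2π)^{d/2}`, `Q` the coefficient of `e^{-βE²/4}`), and `s_k = ε_k^{1/6}`,
`δ = s_k²`, `ε₀ = s_k⁴`, `ā = (L_K+1) ε_k`, `m_bad = 117 d s_k B^{5d+3} |B₁|²`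
(`sphereMeasure_prod_bgsrBadSet_le_of_tuning`), whose remaining error terms tend to `0` with
`ε_k`; the side conditions (`N_k(2ε_k)^d ≤ 1/2`, `L_K ≤ N_k + 1`, `δ ≤ h`, `4ā ≤ ε₀`, the
smallness conditions of the tuning) hold eventually; `ae_tendsto_of_forall_eventually_ae_le`
concludes. This covers the case `α = 1` and the times `t ∈ (0, 1]` which the printed (2.9)
(`α > 1`, `t > 1`, `bgsr_linearBoltzmannApprox_of_inputs`) leaves out, qualitatively.
[cite: BodineauGallagherSaintRaymondInvent2016, Thm 2.2 and its proof via Prop. 5.8, pp. 7, 21] -/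
theorem bgsrAeConvergenceAt_of_inputs [DecidableEq d]
    (hS : 2 ≤ Fintype.card d → ∀ (N : ℕ) (ε : ℝ) (hε : 0 < ε) (hε' : ε < 2⁻¹),
      (N : ℝ) * (2 * ε) ^ Fintype.card d ≤ 2⁻¹ → ∀ (β : ℝ), 0 < β → ∀ (ρ₀ : UnitAddTorus d → ℝ), Continuous ρ₀ →
      (∀ x, 0 ≤ ρ₀ x) → ∫ x, ρ₀ x = 1 → ∀ (T : ℝ), ∀ s ≤ N + 1, ∀ t ∈ Icc 0 T,
        (hsHierarchyModel (d := d) hε hε' (N + 1)).seriesFamily (N + 1)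
            (fun k => bgsrMarginalFamily hε hε' N β ρ₀ k 0) s t =ᵐ[volume]
          bgsrMarginalFamily hε hε' N β ρ₀ s t)
    (hRob : ∀ (N : ℕ) (ε : ℝ) (hε : 0 < ε) (hε' : ε < 2⁻¹),
      (hsHierarchyModel (d := d) hε hε' (N + 1)).RespectsAEOn (fun _ => volume)
        (fun k => hardSphereDomain (Literature.Analysis.FluidPDE.Torus.geometry d) k ε))
    (hReg : ∀ ε : ℝ, 0 < ε → ε < 2⁻¹ → ∀ σ : ℝ, ∀ᵐ z : Config 1 d (UnitAddTorus d), ∀ n, bgsrRegular ε n 1 σ z)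
    {α : ℝ} (hα : 0 < α) :
    BgsrAeConvergenceAt (d := d) α := by
  intro hd β hβ N ε hNε hε2 ρ₀ hρ₀c hρ₀0 hρ₀1 Φ
  obtain ⟨hε0, hεlim, hαk⟩ := hNε
  -- `ρ⁰` is bounded on the compact torus
  obtain ⟨x₀, -, hx₀⟩ := isCompact_univ.exists_isMaxOn univ_nonempty hρ₀c.continuousOn
  set R : ℝ := ρ₀ x₀ with hRdef
  have hR : ∀ x, ρ₀ x ≤ R := fun x => (isMaxOn_iff.1 hx₀) x (mem_univ x)
  have hR0 : 0 ≤ R := hρ₀0 x₀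
  refine ⟨linearBoltzmannSeries (Literature.Analysis.FluidPDE.Torus.geometry d) β α fun x _ => ρ₀ x,
    (isTaggedLinearBoltzmannSolution_linearBoltzmannSeries hβ hα.le hρ₀c hρ₀0 hR).1, fun t ht => ?_⟩
  apply ae_tendsto_of_forall_eventually_ae_le
  intro η hη
  /- ### constants depending on `d, β, α, t, R, η` only -/
  set n := Fintype.card d with hn
  have hn2 : 2 ≤ n := hd
  have hn1 : 1 ≤ n - 1 := by omega
  have hmC := maxwellianConst_pos (d := d) hβ
  set mC := maxwellianConst d β with hmCdef
  set C' : ℝ := max 1 (2 * mC) with hC'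
  set C'' : ℝ := max 1 (4 * mC) with hC''
  set Cm : ℝ := max 1 mC with hCm
  set R' : ℝ := max R 1 with hR'
  have hC'1 : 1 ≤ C' := le_max_left _ _
  have hC''1 : 1 ≤ C'' := le_max_left _ _
  have hCm1 : 1 ≤ Cm := le_max_left _ _
  have hR'1 : 1 ≤ R' := le_max_right _ _
  set Cd : ℝ := (∫ u : EuclideanSpace ℝ d, (1 + ‖u‖) * exp (-(1 / 2) * ‖u‖ ^ 2)) *
      (sphereMeasure (E := EuclideanSpace ℝ d)).real univ with hCd
  have hCd0 : 0 ≤ Cd := mul_nonneg (integral_nonneg fun u => by positivity) measureReal_nonneg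
  set cβ : ℝ := 4 * sqrt 2 * Cd * sqrt 2 ^ n / sqrt β ^ (n + 1) with hcβ
  set cβ' : ℝ := 4 * sqrt 2 * Cd * sqrt 2 ^ n / sqrt (β / 2) ^ (n + 1) with hcβ'
  have hcβ0 : 0 ≤ cβ := by positivity
  have hcβ'0 : 0 ≤ cβ' := by positivity
  -- the pruning parameter `γ` (`A = 2`)
  set Gc : ℝ := 4 * R * C' + 2 * R' * Cm + 1 with hGc
  have hGc0 : 0 < Gc := by positivity
  set γ : ℝ := min 2⁻¹ (η / (8 * Gc)) with hγ
  have hγ0 : 0 < γ := lt_min (by norm_num) (by positivity)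
  have hγhalf : γ ≤ 2⁻¹ := min_le_left _ _
  have hγη : γ ≤ η / (8 * Gc) := min_le_right _ _
  have hγ1 : γ ≤ 1 := hγhalf.trans (by norm_num)
  -- the number of blocks `K` and the step `h = t / K`
  set K : ℕ := ⌈exp 2 * C' * (cβ * α) * t / γ⌉₊ + 1 with hK
  have hK1 : 1 ≤ K := by omega
  have hK0 : (0 : ℝ) < K := by exact_mod_cast hK1
  have hKge : exp 2 * C' * (cβ * α) * t / γ ≤ K := by
    rw [hK]; push_cast
    exact (Nat.le_ceil _).trans (by linarith)
  set h : ℝ := t / K with hh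
  have hh0 : 0 < h := div_pos ht hK0
  have hKh : (K : ℝ) * h = t := by rw [hh]; field_simp
  have hsmall : C' * (cβ * α) * h ≤ γ / exp 2 := by
    rw [hh, le_div_iff₀ (exp_pos 2)]
    have h1 : exp 2 * C' * (cβ * α) * t ≤ γ * K := by rwa [div_le_iff₀ hγ0, mul_comm (K : ℝ)] at hKge
    calc C' * (cβ * α) * (t / K) * exp 2 = exp 2 * C' * (cβ * α) * t / K := by ring
      _ ≤ γ * K / K := by gcongr
      _ = γ := by field_simp
  -- the energy cut-off `E`
  set P : ℝ := (2 : ℝ) ^ K with hP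
  have hP1 : 1 ≤ P := one_le_pow₀ (by norm_num)
  set Q : ℝ := R * C' * exp (6 * (C' * (cβ' * α) * h) * P) + R' * Cm * exp (6 * (Cm * (cβ' * α) * h) * P) with hQ
  have hQ0 : 0 ≤ Q := by positivity
  set y : ℝ := max 1 (Real.log (4 * (Q + 1) / η)) with hy
  have hy1 : 1 ≤ y := le_max_left _ _
  set E : ℝ := sqrt (4 / β * y) with hE
  have hE0 : 0 < E := Real.sqrt_pos.2 (by positivity)
  have hEsq : β * E ^ 2 / 4 = y := by
    rw [hE, Real.sq_sqrt (by positivity)]; field_simp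
  have heE : exp (-(β * E ^ 2 / 4)) * (Q + 1) ≤ η / 4 := by
    rw [hEsq]
    have h1 : exp (-y) ≤ exp (-Real.log (4 * (Q + 1) / η)) := exp_le_exp.2 (neg_le_neg (le_max_right _ _))
    have h2 : exp (-Real.log (4 * (Q + 1) / η)) = η / (4 * (Q + 1)) := by
      rw [Real.exp_neg, Real.exp_log (by positivity), inv_div]
    calc exp (-y) * (Q + 1) ≤ η / (4 * (Q + 1)) * (Q + 1) := by rw [← h2]; gcongr
      _ = η / 4 := by field_simp
  /- ### the `k`-dependent parameters and the vanishing error terms -/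
  set L : ℕ := pruneLevel 2 K with hL
  set a₀ : ℝ := (L : ℝ) + 1 with ha₀
  have ha₀1 : 1 ≤ a₀ := by rw [ha₀]; have := (Nat.cast_nonneg L : (0 : ℝ) ≤ L); linarith
  have ha₀0 : 0 ≤ a₀ := zero_le_one.trans ha₀1
  set V : ℝ := (volume (ball (0 : EuclideanSpace ℝ d) 1)).toReal with hV
  set B : ℝ := 36 + (L : ℝ) + 4 * E + (6 * (t * E) + 2) + a₀ with hB
  have hB0 : 0 ≤ B := by have := hE0.le; have := ht.le; positivity
  set cBad : ℝ := 117 * n * B ^ (5 * n + 3) * V ^ 2 with hcBad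
  have hcBad0 : 0 ≤ cBad := by positivity
  set sq : ℕ → ℝ := fun k => ε k ^ ((1 : ℝ) / 6) with hsq
  have hsq0 : ∀ k, 0 < sq k := fun k => Real.rpow_pos_of_pos (hε0 k) _
  have hsq6 : ∀ k, sq k ^ 6 = ε k := fun k => rpow_sixth_pow_six (hε0 k).le
  have hsqlim : Tendsto sq atTop (𝓝 0) := tendsto_rpow_sixth_of_tendsto_zero hεlim
  -- the coefficients of the vanishing terms
  set X₂ : ℝ := exp (12 * (C' * (cβ * α) * h) * (2 : ℝ) ^ K) with hX₂
  set X₃ : ℝ := exp ((6 * (cβ * α) + 12 * α) * C'' * h * (2 : ℝ) ^ K) with hX₃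
  set X₅ : ℝ := exp (12 * (Cm * (cβ * α) * h) * (2 : ℝ) ^ K) with hX₅
  set D₁ : ℝ := 12 * R * C' * (C' * (cβ * α)) * ((2 : ℝ) ^ K) ^ 2 * X₂ +
      12 * (2 * R) * C' * (C' * (cβ * α)) * ((2 : ℝ) ^ K) ^ 2 * X₂ +
      12 * R' * Cm * (Cm * (cβ * α)) * ((2 : ℝ) ^ K) ^ 2 * X₅ with hD₁
  set D₂ : ℝ := C'' * X₃ * (2 * R * (2 ^ n * α)) with hD₂
  set D₃ : ℝ := C'' * X₃ * (6 * R' * (2 : ℝ) ^ K * (L / α)) with hD₃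
  set D₄ : ℝ := C'' * X₃ * (6 * R' * (2 : ℝ) ^ K * (4 * E * cBad)) with hD₄
  set W : ℕ → ℝ := fun k => D₁ * sq k ^ 2 + D₂ * ε k + D₃ * ε k ^ (n - 1) + D₄ * sq k with hW
  have hWlim : Tendsto W atTop (𝓝 0) := by
    have h1 : Tendsto (fun k => D₁ * sq k ^ 2) atTop (𝓝 0) := by
      simpa using (hsqlim.pow 2).const_mul D₁
    have h2 : Tendsto (fun k => D₂ * ε k) atTop (𝓝 0) := by simpa using hεlim.const_mul D₂
    have h3 : Tendsto (fun k => D₃ * ε k ^ (n - 1)) atTop (𝓝 0) := by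
      have := (hεlim.pow (n - 1)).const_mul D₃
      rwa [zero_pow (by omega), mul_zero] at this
    have h4 : Tendsto (fun k => D₄ * sq k) atTop (𝓝 0) := by simpa using hsqlim.const_mul D₄
    simpa [hW] using ((h1.add h2).add h3).add h4
  /- ### the conditions holding eventually -/
  have e1 : ∀ᶠ k in atTop, sq k ≤ 1 := hsqlim.eventually (Iic_mem_nhds one_pos)
  have e2 : ∀ᶠ k in atTop, 12 * a₀ * sq k ^ 2 ≤ 1 := by
    have : Tendsto (fun k => 12 * a₀ * sq k ^ 2) atTop (𝓝 0) := by
      simpa using (hsqlim.pow 2).const_mul (12 * a₀)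
    exact this.eventually (Iic_mem_nhds one_pos)
  have e3 : ∀ᶠ k in atTop, sq k ^ 4 ≤ 1 / 12 := by
    have : Tendsto (fun k => sq k ^ 4) atTop (𝓝 0) := by simpa using hsqlim.pow 4
    exact this.eventually (Iic_mem_nhds (by norm_num))
  have e4 : ∀ᶠ k in atTop, sq k ^ 2 ≤ E := by
    have : Tendsto (fun k => sq k ^ 2) atTop (𝓝 0) := by simpa using hsqlim.pow 2
    exact this.eventually (Iic_mem_nhds hE0)
  have e5 : ∀ᶠ k in atTop, sq k ^ 2 ≤ h := by
    have : Tendsto (fun k => sq k ^ 2) atTop (𝓝 0) := by simpa using hsqlim.pow 2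
    exact this.eventually (Iic_mem_nhds hh0)
  have e6 : ∀ᶠ k in atTop, 2 ^ n * α * ε k ≤ 2⁻¹ := by
    have : Tendsto (fun k => 2 ^ n * α * ε k) atTop (𝓝 0) := by simpa using hεlim.const_mul (2 ^ n * α)
    exact this.eventually (Iic_mem_nhds (by norm_num))
  have e7 : ∀ᶠ k in atTop, (L : ℝ) * ε k ^ (n - 1) ≤ α := by
    have : Tendsto (fun k => (L : ℝ) * ε k ^ (n - 1)) atTop (𝓝 0) := by
      have := (hεlim.pow (n - 1)).const_mul (L : ℝ)
      rwa [zero_pow (by omega), mul_zero] at this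
    exact this.eventually (Iic_mem_nhds hα)
  have e8 : ∀ᶠ k in atTop, W k ≤ η / 2 := hWlim.eventually (Iic_mem_nhds (by positivity))
  filter_upwards [e1, e2, e3, e4, e5, e6, e7, e8] with k hk1 hk2 hk3 hk4 hk5 hk6 hk7 hk8
  /- ### the comparison at the `k`-th term of the sequence -/
  have hεk := hε0 k
  have hεk' := hε2 k
  have hs0 := hsq0 k
  have hαN : α = ((N k : ℝ) + 1) * ε k ^ (n - 1) := by
    have := hαk k; push_cast at this; rw [hn]; exact this.symm
  have hNε : ((N k : ℝ) + 1) * ε k ^ n = α * ε k := by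
    rw [hαN, mul_assoc, ← pow_succ, Nat.sub_add_cancel (by omega)]
  have hN : (N k : ℝ) * (2 * ε k) ^ Fintype.card d ≤ 2⁻¹ := by
    rw [← hn, mul_pow]
    calc (N k : ℝ) * (2 ^ n * ε k ^ n) ≤ ((N k : ℝ) + 1) * (2 ^ n * ε k ^ n) := by
          have : 0 ≤ (2 : ℝ) ^ n * ε k ^ n := by have := hεk.le; positivity
          exact mul_le_mul_of_nonneg_right (by linarith only) this
      _ = 2 ^ n * (((N k : ℝ) + 1) * ε k ^ n) := by ring
      _ = 2 ^ n * (α * ε k) := by rw [hNε]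
      _ = 2 ^ n * α * ε k := by ring
      _ ≤ 2⁻¹ := hk6
  have hLN : L ≤ N k + 1 := by
    have h1 : (L : ℝ) * ε k ^ (n - 1) ≤ ((N k : ℝ) + 1) * ε k ^ (n - 1) := by rw [← hαN]; exact hk7
    have h2 : (L : ℝ) ≤ (N k : ℝ) + 1 := le_of_mul_le_mul_right h1 (pow_pos hεk _)
    exact_mod_cast h2
  have hāε₀ : 4 * (a₀ * sq k ^ 6) ≤ sq k ^ 4 := by
    have h1 : 4 * a₀ * sq k ^ 2 ≤ 1 := by
      have h2 : 0 ≤ a₀ * sq k ^ 2 := mul_nonneg ha₀0 (sq_nonneg _)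
      linarith only [hk2, h2]
    calc 4 * (a₀ * sq k ^ 6) = (4 * a₀ * sq k ^ 2) * sq k ^ 4 := by ring
      _ ≤ 1 * sq k ^ 4 := mul_le_mul_of_nonneg_right h1 (by positivity)
      _ = sq k ^ 4 := one_mul _
  have hLε : ((L : ℝ) + 1) * ε k ≤ a₀ * sq k ^ 6 := by rw [hsq6, ha₀]
  -- the bad-set bound
  set mBad : ℝ := sq k * cBad with hmBad
  have hmBad0 : 0 ≤ mBad := mul_nonneg hs0.le hcBad0
  have hmBadH : ∀ k' ≤ pruneLevel 2 K, ∀ (Y : Config k' d (UnitAddTorus d)) (m : Fin k') (σ' : ℝ), 0 ≤ σ' →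
      Y ∈ bgsrGoodConfigs (Literature.Analysis.FluidPDE.Torus.geometry d) k' (sq k ^ 4) σ' →
      ((sphereMeasure (E := EuclideanSpace ℝ d)).prod (volume : Measure (EuclideanSpace ℝ d)))
          {q : sphere (0 : EuclideanSpace ℝ d) 1 × EuclideanSpace ℝ d |
            ‖q.2‖ ≤ E ∧ ((q.1 : EuclideanSpace ℝ d), q.2) ∈
              bgsrBadSet (K * h) (a₀ * sq k ^ 6) (sq k ^ 4) (sq k ^ 2) (3 * E) Y m} ≤
        ENNReal.ofReal mBad := by
    intro k' hk' Y m σ' hσ' hY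
    have hsep : ∀ j : Fin k', j ≠ m → sq k ^ 4 ≤ euclidDist (Y m).1 (Y j).1 := fun j hj =>
      euclidDist_ge_of_mem_bgsrGoodConfigs hσ' hY (Ne.symm hj)
    refine (sphereMeasure_prod_bgsrBadSet_le_of_tuning hd hs0 hk1 (t := K * h) (by positivity) hE0 ha₀1
      hk2 hk3 hk4 hsep).trans (ENNReal.ofReal_le_ofReal ?_)
    rw [hKh, ← hn, ← hV]
    have hk'' : (k' : ℝ) ≤ L := by exact_mod_cast hk'
    have hBk : 36 + (k' : ℝ) + 4 * E + (6 * (t * E) + 2) + a₀ ≤ B := by rw [hB]; linarith only [hk'']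
    have hBk0 : 0 ≤ 36 + (k' : ℝ) + 4 * E + (6 * (t * E) + 2) + a₀ := by
      have := hE0.le; have := ht.le; positivity
    rw [hmBad, hcBad]
    have h117 : 0 ≤ (117 : ℝ) * n := by positivity
    calc sq k * (117 * n * (36 + (k' : ℝ) + 4 * E + (6 * (t * E) + 2) + a₀) ^ (5 * n + 3)) * V ^ 2
        ≤ sq k * (117 * n * B ^ (5 * n + 3)) * V ^ 2 := by gcongr
      _ = sq k * (117 * n * B ^ (5 * n + 3) * V ^ 2) := by ring
  -- the two models and their pruning constants
  set M₁ := hsHierarchyModel (d := d) hεk hεk' (N k + 1) with hM₁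
  set M₂ := boltzmannModel (Literature.Analysis.FluidPDE.Torus.geometry d) measurable_translate_torus α
    with hM₂
  have hpc₁ : ∀ b, M₁.pruneConst b = 4 * sqrt 2 * Cd * sqrt 2 ^ n / sqrt b ^ (n + 1) * α := by
    intro b
    rw [hM₁, pruneConst_hsHierarchyModel, hαN, ← hCd, ← hn]
    push_cast; ring
  have hpc₂ : ∀ b, M₂.pruneConst b = 4 * sqrt 2 * Cd * sqrt 2 ^ n / sqrt b ^ (n + 1) * α := by
    intro b
    rw [hM₂, pruneConst_boltzmannModel_torus hα.le, ← hCd, ← hn]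
  have hpcβ₁ : M₁.pruneConst β = cβ * α := by rw [hpc₁, hcβ]
  have hpcβ₁' : M₁.pruneConst (β / 2) = cβ' * α := by rw [hpc₁, hcβ']
  have hpcβ₂ : M₂.pruneConst β = cβ * α := by rw [hpc₂, hcβ]
  have hpcβ₂' : M₂.pruneConst (β / 2) = cβ' * α := by rw [hpc₂, hcβ']
  have hsmall₁ : max 1 (2 * maxwellianConst d β) * M₁.pruneConst β * h ≤ γ / exp 2 := by
    rw [hpcβ₁, ← hmCdef, ← hC', ← mul_assoc] at *
    simpa [mul_assoc] using hsmall
  -- the assembled comparison at time `K h = t`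
  have hSdom : ∀ s' ≤ N k + 1, ∀ t' ∈ Icc 0 t,
      (hsHierarchyModel (d := d) hεk hεk' (N k + 1)).seriesFamily (N k + 1)
          (fun j => bgsrMarginalFamily hεk hεk' (N k) β ρ₀ j 0) s' t' =ᵐ[hsDomMeasure (d := d) (ε k) s']
        bgsrMarginalFamily hεk hεk' (N k) β ρ₀ s' t' :=
    fun s' hs' t' ht' => seriesFamily_ae_eq_bgsrMarginalFamily_dom_of_ae hεk hεk' (N k) β ρ₀ (hS hd (N k) (ε k) hεk hεk' hN β hβ ρ₀ hρ₀c hρ₀0 hρ₀1 t s' hs' t' ht')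
  have hRobdom : (hsHierarchyModel (d := d) hεk hεk' (N k + 1)).RespectsAE (hsDomMeasure (ε k)) :=
    respectsAE_hsDomMeasure_of_domain hεk hεk' (N k + 1) (hRob (N k) (ε k) hεk hεk')
  have hmain := ae_abs_bgsrMarginalFamily_sub_bgsrHierarchyFamily_le_dom hεk hεk' (N k) hβ hρ₀c hρ₀0 hR hN hαN
    hSdom hRobdom (le_refl 2) hK1 (pow_pos hs0 2) hk5 hKh.le
    hγ0.le (hγhalf.trans_eq (by norm_num)) hsmall₁ hE0.le hāε₀ hLε hLN hmBad0 hmBadH (hReg (ε k) hεk hεk' (K * h))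
  rw [hKh] at hmain
  rw [hpcβ₁, hpcβ₁', hpcβ₂, hpcβ₂'] at hmain
  /- ### the bound is at most `η` -/
  have heE0 : 0 ≤ exp (-(β * E ^ 2 / 4)) := (exp_pos _).le
  have hγ2 : γ ^ 2 ≤ γ := by rw [pow_two]; exact mul_le_of_le_one_right hγ0.le hγ1
  have hGγ : 4 * γ ^ 2 * R * C' + 2 * γ ^ 2 * R' * Cm ≤ η / 8 := by
    have h1 : 4 * γ ^ 2 * R * C' + 2 * γ ^ 2 * R' * Cm ≤ γ * Gc := by
      have h0 : 0 ≤ 4 * R * C' + 2 * R' * Cm := by positivity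
      calc 4 * γ ^ 2 * R * C' + 2 * γ ^ 2 * R' * Cm = γ ^ 2 * (4 * R * C' + 2 * R' * Cm) := by ring
        _ ≤ γ * (4 * R * C' + 2 * R' * Cm) := mul_le_mul_of_nonneg_right hγ2 h0
        _ ≤ γ * Gc := mul_le_mul_of_nonneg_left (by rw [hGc]; linarith only) hγ0.le
    have h2 : γ * Gc ≤ η / (8 * Gc) * Gc := mul_le_mul_of_nonneg_right hγη hGc0.le
    have h3 : η / (8 * Gc) * Gc = η / 8 := by field_simp
    linarith only [h1, h2, h3]
  have hEQ : exp (-(β * E ^ 2 / 4)) * Q ≤ η / 4 :=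
    (mul_le_mul_of_nonneg_left (by linarith only [hQ0] : Q ≤ Q + 1) heE0).trans heE
  have hdata : 2 * R * ((N k : ℝ) + 1) * (2 * ε k) ^ n = 2 * R * (2 ^ n * (α * ε k)) := by
    rw [mul_pow, show 2 * R * ((N k : ℝ) + 1) * (2 ^ n * ε k ^ n) = 2 * R * (2 ^ n * (((N k : ℝ) + 1) * ε k ^ n)) by ring,
      hNε]
  have hbd : (4 * γ ^ 2 * R * C' +
      R * exp (-(β * E ^ 2 / 4)) * C' * exp (6 * (C' * (cβ' * α) * h) * (2 : ℝ) ^ K) +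
      12 * R * C' * (C' * (cβ * α) * sq k ^ 2) * (2 : ℝ) ^ (2 * K) * exp (12 * (C' * (cβ * α) * h) * (2 : ℝ) ^ K)) +
      12 * (2 * R) * C' * (C' * (cβ * α) * sq k ^ 2) * (2 : ℝ) ^ (2 * K) * exp (12 * (C' * (cβ * α) * h) * (2 : ℝ) ^ K) +
      C'' * (2 * R * ((N k : ℝ) + 1) * (2 * ε k) ^ n + 6 * R' * (2 : ℝ) ^ K * ((L : ℝ) * ε k ^ (n - 1) / α + 4 * E * mBad)) *
        exp ((6 * (cβ * α) + 12 * α) * C'' * h * (2 : ℝ) ^ K) +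
      (2 * γ ^ 2 * R' * Cm + R' * exp (-(β * E ^ 2 / 4)) * Cm * exp (6 * (Cm * (cβ' * α) * h) * (2 : ℝ) ^ K) +
        12 * R' * Cm * (Cm * (cβ * α) * sq k ^ 2) * (2 : ℝ) ^ (2 * K) * exp (12 * (Cm * (cβ * α) * h) * (2 : ℝ) ^ K)) ≤ η := by
    rw [hdata, pow_mul' (2 : ℝ) 2 K]
    have hid : (4 * γ ^ 2 * R * C' +
        R * exp (-(β * E ^ 2 / 4)) * C' * exp (6 * (C' * (cβ' * α) * h) * (2 : ℝ) ^ K) +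
        12 * R * C' * (C' * (cβ * α) * sq k ^ 2) * ((2 : ℝ) ^ K) ^ 2 * exp (12 * (C' * (cβ * α) * h) * (2 : ℝ) ^ K)) +
        12 * (2 * R) * C' * (C' * (cβ * α) * sq k ^ 2) * ((2 : ℝ) ^ K) ^ 2 * exp (12 * (C' * (cβ * α) * h) * (2 : ℝ) ^ K) +
        C'' * (2 * R * (2 ^ n * (α * ε k)) + 6 * R' * (2 : ℝ) ^ K * ((L : ℝ) * ε k ^ (n - 1) / α + 4 * E * mBad)) *
          exp ((6 * (cβ * α) + 12 * α) * C'' * h * (2 : ℝ) ^ K) +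
        (2 * γ ^ 2 * R' * Cm + R' * exp (-(β * E ^ 2 / 4)) * Cm * exp (6 * (Cm * (cβ' * α) * h) * (2 : ℝ) ^ K) +
          12 * R' * Cm * (Cm * (cβ * α) * sq k ^ 2) * ((2 : ℝ) ^ K) ^ 2 * exp (12 * (Cm * (cβ * α) * h) * (2 : ℝ) ^ K)) =
        (4 * γ ^ 2 * R * C' + 2 * γ ^ 2 * R' * Cm) + exp (-(β * E ^ 2 / 4)) * Q + W k := by
      simp only [hQ, hW, hD₁, hD₂, hD₃, hD₄, hX₂, hX₃, hX₅, hP, hmBad]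
      field_simp
      ring
    rw [hid]
    linarith only [hGγ, hEQ, hk8, hη]
  /- ### transfer to the one-particle phase space -/
  have hfin : ∀ᵐ Z : Config 1 d (UnitAddTorus d),
      |bgsrMarginalFamily (d := d) hεk hεk' (N k) β ρ₀ 1 t (fun _ => Z 0) -
          bgsrHierarchyFamily β
            (linearBoltzmannSeries (Literature.Analysis.FluidPDE.Torus.geometry d) β α fun x _ => ρ₀ x) 1 t
            (fun _ => Z 0)| ≤ η := by
    filter_upwards [hmain] with Z hZ
    rw [config_one_eq_const Z] at hZ
    exact hZ.trans hbd
  have hfin' := ae_prod_of_ae_config_one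
    (P := fun z => |bgsrMarginalFamily (d := d) hεk hεk' (N k) β ρ₀ 1 t (fun _ => z) -
          bgsrHierarchyFamily β
            (linearBoltzmannSeries (Literature.Analysis.FluidPDE.Torus.geometry d) β α fun x _ => ρ₀ x) 1 t
            (fun _ => z)| ≤ η) hfin
  filter_upwards [hfin', bgsrTaggedMarginal_ae_eq_bgsrMarginalFamily hεk hεk' (N k) β ρ₀ (Φ k) t] with z hz hz'
  rw [hz', mul_comm (maxwellianBeta β z.2),
    ← bgsrHierarchyFamily_one_const β
      (linearBoltzmannSeries (Literature.Analysis.FluidPDE.Torus.geometry d) β α fun x _ => ρ₀ x) t z]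
  exact hz

/-! ## §3. Fact (c) from the inputs -/

/-- **The linear Boltzmann limit of the tagged sphere (BGSR Thm 2.2 in its weak-convergence form
(c)) at every inverse mean free path `α > 0`, from the three inputs (S), (R), (Reg)**:
`bgsrAeConvergenceAt_of_inputs` fed to N1's `linearBoltzmannLimitAt_of_ae` (limit `g = M_β φ_α`,
mild solution of `∂ₜ g + v·∇ₓ g = α Q(g, M_β)`, weak convergence of the tagged laws for every
`t ≥ 0` and every bounded continuous test function). [cite: BodineauGallagherSaintRaymondInvent2016, Thm. 2.2] -/
theorem linearBoltzmannLimitAt_of_inputs [DecidableEq d]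
    (hS : 2 ≤ Fintype.card d → ∀ (N : ℕ) (ε : ℝ) (hε : 0 < ε) (hε' : ε < 2⁻¹),
      (N : ℝ) * (2 * ε) ^ Fintype.card d ≤ 2⁻¹ → ∀ (β : ℝ), 0 < β → ∀ (ρ₀ : UnitAddTorus d → ℝ), Continuous ρ₀ →
      (∀ x, 0 ≤ ρ₀ x) → ∫ x, ρ₀ x = 1 → ∀ (T : ℝ), ∀ s ≤ N + 1, ∀ t ∈ Icc 0 T,
        (hsHierarchyModel (d := d) hε hε' (N + 1)).seriesFamily (N + 1)
            (fun k => bgsrMarginalFamily hε hε' N β ρ₀ k 0) s t =ᵐ[volume]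
          bgsrMarginalFamily hε hε' N β ρ₀ s t)
    (hRob : ∀ (N : ℕ) (ε : ℝ) (hε : 0 < ε) (hε' : ε < 2⁻¹),
      (hsHierarchyModel (d := d) hε hε' (N + 1)).RespectsAEOn (fun _ => volume)
        (fun k => hardSphereDomain (Literature.Analysis.FluidPDE.Torus.geometry d) k ε))
    (hReg : ∀ ε : ℝ, 0 < ε → ε < 2⁻¹ → ∀ σ : ℝ, ∀ᵐ z : Config 1 d (UnitAddTorus d), ∀ n, bgsrRegular ε n 1 σ z)
    {α : ℝ} (hα : 0 < α) :
    LinearBoltzmannLimitAt (d := d) α :=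
  linearBoltzmannLimitAt_of_ae (bgsrAeConvergenceAt_of_inputs hS hRob hReg hα)

/-- **Fact (c) `bodineau_gallagher_saintRaymond_linear` (`ShortRangePotentials`: BGSR Thm 2.2 at
`α = 1`, van Beijeren–Lanford–Lebowitz–Spohn 1980) from the three inputs (S), (R), (Reg) on the
hard-sphere dynamics** — the iterated Duhamel formula up to null sets for the marginals along the
regularised flows, the null-set robustness of the hard-sphere Duhamel terms, and the almost-sure
regularity of the BBGKY pseudo-trajectories: `linearBoltzmannLimitAt_of_inputs` at `α = 1` and
N1's `bodineau_gallagher_saintRaymond_linear_of_limitAt_one`. What remains of the named fact is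
exactly these three inputs (shared with `bgsr_linearBoltzmannApprox_of_inputs`).
[cite: BodineauGallagherSaintRaymondInvent2016, Thm. 2.2] -/
theorem bodineau_gallagher_saintRaymond_linear_of_inputs [DecidableEq d]
    (hS : 2 ≤ Fintype.card d → ∀ (N : ℕ) (ε : ℝ) (hε : 0 < ε) (hε' : ε < 2⁻¹),
      (N : ℝ) * (2 * ε) ^ Fintype.card d ≤ 2⁻¹ → ∀ (β : ℝ), 0 < β → ∀ (ρ₀ : UnitAddTorus d → ℝ), Continuous ρ₀ →
      (∀ x, 0 ≤ ρ₀ x) → ∫ x, ρ₀ x = 1 → ∀ (T : ℝ), ∀ s ≤ N + 1, ∀ t ∈ Icc 0 T,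
        (hsHierarchyModel (d := d) hε hε' (N + 1)).seriesFamily (N + 1)
            (fun k => bgsrMarginalFamily hε hε' N β ρ₀ k 0) s t =ᵐ[volume]
          bgsrMarginalFamily hε hε' N β ρ₀ s t)
    (hRob : ∀ (N : ℕ) (ε : ℝ) (hε : 0 < ε) (hε' : ε < 2⁻¹),
      (hsHierarchyModel (d := d) hε hε' (N + 1)).RespectsAEOn (fun _ => volume)
        (fun k => hardSphereDomain (Literature.Analysis.FluidPDE.Torus.geometry d) k ε))
    (hReg : ∀ ε : ℝ, 0 < ε → ε < 2⁻¹ → ∀ σ : ℝ, ∀ᵐ z : Config 1 d (UnitAddTorus d), ∀ n, bgsrRegular ε n 1 σ z) :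
    bodineau_gallagher_saintRaymond_linear (d := d) :=
  bodineau_gallagher_saintRaymond_linear_of_limitAt_one (linearBoltzmannLimitAt_of_inputs hS hRob hReg one_pos)

/-- **Fact (c) from the iterated Duhamel formula (S) alone.** The inputs (R') and (Reg) of
`bodineau_gallagher_saintRaymond_linear_of_inputs` are theorems
(`respectsAEOn_hsHierarchyModel`, `HardSphereBBGKYRobustness`; `ae_bgsrRegular_one`,
`HardSphereBBGKYRegularity`), both for `d ≥ 2`, which the fact supplies first; so BGSR's
Theorem 2.2 in the form (c) follows from the single remaining input (S): the finite Duhamel series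
of the hard-sphere hierarchy model reproduces the marginals of the transported BGSR datum,
Lebesgue-almost everywhere (CIP 1994 Thm 4.3.1 / Spohn 2006 Prop. 5 and Thm 11, iterated).
[cite: BodineauGallagherSaintRaymondInvent2016, Thm. 2.2, p. 5] -/
theorem bodineau_gallagher_saintRaymond_linear_of_S [DecidableEq d]
    (hS : 2 ≤ Fintype.card d → ∀ (N : ℕ) (ε : ℝ) (hε : 0 < ε) (hε' : ε < 2⁻¹),
      (N : ℝ) * (2 * ε) ^ Fintype.card d ≤ 2⁻¹ → ∀ (β : ℝ), 0 < β → ∀ (ρ₀ : UnitAddTorus d → ℝ), Continuous ρ₀ →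
      (∀ x, 0 ≤ ρ₀ x) → ∫ x, ρ₀ x = 1 → ∀ (T : ℝ), ∀ s ≤ N + 1, ∀ t ∈ Icc 0 T,
        (hsHierarchyModel (d := d) hε hε' (N + 1)).seriesFamily (N + 1)
            (fun k => bgsrMarginalFamily hε hε' N β ρ₀ k 0) s t =ᵐ[volume]
          bgsrMarginalFamily hε hε' N β ρ₀ s t) :
    bodineau_gallagher_saintRaymond_linear (d := d) := fun hd =>
  bodineau_gallagher_saintRaymond_linear_of_inputs hS
    (fun N _ hε hε' => respectsAEOn_hsHierarchyModel hε hε' (N + 1) hd)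
    (fun _ hε hε' σ => ae_bgsrRegular_one hε hε' hd σ) hd

end Kinetic

end

end Literature.MathematicalPhysics.KineticTheory
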